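import Summits.CriticalPhenomena.PercolationContinuityZ3.Theorems.PercNearOneGluingNoHeavyLowerTailAntitheticOneSum
import Summits.CriticalPhenomena.PercolationContinuityZ3.Theorems.PercNearOneGluingNoHeavyLowerTailAntitheticHandlePrinciple
import HarnessLib

/-!
# `NoHeavyLowerTail` (stmt-CriticalPhenomena-4575) — antithetic cluster pairs: the **DUAL HANDLE THEOREM** — Δ2 for `K` + a handle at
# `(P, Q)` from ⊕-positivity of `(K, s, P)` and the mixed sum of `(K; P, Q)` ALONE (prim-hp-2 gen 64, HOME/MEMO-gen64.md §2)

Support file (`--supports stmt-CriticalPhenomena-4575`, hull-port prover `prim-hp-2`, gen 64).  No definitions, no named facts, no sorries;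
standard axioms.  VERTEX version; notation of …AntitheticHandlePrinciple (`⊕_E(P; K) = Σ_{T : P ∈ X} K₁K₂(X,Y)`,
`TII_E(P, Q; K) = Σ_{T : P ∈ X, Q ∉ Y} K₁K₂(X,Y)`, 𝒮 = super-odd twisted-monotone pairs).

The HANDLE PRINCIPLE (`Antithetic.Pendant.handle_vertex_sum_nonneg_of`, gen 62) needs (⊕_j): `K ∪ stub_j` ⊕-positive at `P` for EVERY
stub `w 0 = Q, …, w j` (`j < b`), and (M).  By the 1-SUM LEMMA (…AntitheticOneSum: ⊕-positivity survives hanging any graph at one vertex —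
Harris over the hung graph's cluster cube, no boxes) every (⊕_j) follows from (⊕_0) = ⊕-positivity of `K` itself:
* `Antithetic.Pendant.oplus_stub_of_oplus` — `(E₀, s, P)` ⊕-positive ⇒ `(E₀ ∪ stub_j, s, P)` ⊕-positive (any `j ≤ b`);
* `Antithetic.Pendant.handle_vertex_sum_nonneg_of_oplus` — **DUAL HANDLE THEOREM**: `K` any loop-free finite graph through `s`, `P, Q`
  vertices; if (⊕) `Σ_{T : P ∈ X_{E₀}} K₁K₂ ≥ 0` and (M) `Σ_{T : P ∈ X_{E₀}, Q ∉ Y_{E₀}} K₁K₂ ≥ 0` for all `K₁, K₂ ∈ 𝒮` — two FINITE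
  conditions on `K`, certifiable by boxes (…AntitheticHandleOplus) or by checked pair-cube certificates (…AntitheticVectorCert) — then
  for all arm lengths `a, b ≥ 0` and all monotone `F, G` the vertex antithetic inequality at `R = {x}` (CONJECTURE Δ2) holds for
  `K ∪ (P – u 1 – … – u a = y) ∪ (Q – w 1 – … – w b = z) + xy + xz`.
So the ⊕-hypothesis of every handle theorem is a property of the base graph alone, and non-boxable ⊕-positive cores (`K₄`, `K₄ − e` at the
apex, `K_{2,3}` at a pole, … — HOME/MEMO-gen63.md §5) carry handles of every length as soon as their two finite sums are certified.
[cite: VandenbergHaggstromKahn2005, §1 p. 6 ("Harris' inequality"), §1 p. 3 (open cluster `C_s`)]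
-/

noncomputable section

namespace Summit.CriticalPhenomena.PercolationContinuityZ3.Theorems

open Literature.Probability.Percolation
open scoped Classical

namespace Antithetic

namespace Pendant

variable {V : Type*} [Fintype V] {E₀ : Set (Sym2 V)} {s P : V} {w : ℕ → V} {b : ℕ}
  (hnd : ∀ f ∈ E₀, ¬ f.IsDiag)
  (hwfresh : ∀ i, 0 < i → i ≤ b → ∀ f ∈ E₀, w i ∈ f → f.IsDiag)
  (hwinj : ∀ i j, i ≤ b → j ≤ b → w i = w j → i = j)
  (hsw : ∀ i, 0 < i → i ≤ b → s ≠ w i) (hPw : ∀ i, 0 < i → i ≤ b → P ≠ w i)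
  (hoplus : ∀ K₁ K₂ : Set V → Set V → ℝ,
    (∀ ⦃A A' B B' : Set V⦄, A ⊆ A' → B' ⊆ B → K₁ A B ≤ K₁ A' B') → (∀ A B, 0 ≤ K₁ A B + K₁ B A) →
    (∀ ⦃A A' B B' : Set V⦄, A ⊆ A' → B' ⊆ B → K₂ A B ≤ K₂ A' B') → (∀ A B, 0 ≤ K₂ A B + K₂ B A) →
    0 ≤ ∑ T ∈ Finset.univ.filter (fun T : Set (Sym2 V) => P ∈ openCluster (T ∩ E₀) s),
      K₁ (openCluster (T ∩ E₀) s) (openCluster (Tᶜ ∩ E₀) s) * K₂ (openCluster (T ∩ E₀) s) (openCluster (Tᶜ ∩ E₀) s))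
include hnd hwfresh hwinj hsw hPw hoplus

omit hwinj in
/-- **(⊕) along the stub from (⊕) of `K`.**  If `(E₀, s, P)` is ⊕-positive then so is `(stub_j ∪ E₀, s, P)` for the pendant stub
`w 0, …, w j` of fresh vertices (`j ≤ b`): a 1-sum at `w 0`.  (The edge set is written `stub_j ∪ E₀`; `oplus_stub_of_boxes` concludes the
same for `E₀ ∪ stub_j` from a box partition — here the hypothesis is ⊕-positivity of `K` alone.) [this work] -/
theorem oplus_stub_of_oplus {j : ℕ} (hj : j ≤ b) (K₁ K₂ : Set V → Set V → ℝ)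
    (hK₁ : ∀ ⦃A A' B B' : Set V⦄, A ⊆ A' → B' ⊆ B → K₁ A B ≤ K₁ A' B') (hso₁ : ∀ A B, 0 ≤ K₁ A B + K₁ B A)
    (hK₂ : ∀ ⦃A A' B B' : Set V⦄, A ⊆ A' → B' ⊆ B → K₂ A B ≤ K₂ A' B') (hso₂ : ∀ A B, 0 ≤ K₂ A B + K₂ B A) :
    0 ≤ ∑ T ∈ Finset.univ.filter (fun T : Set (Sym2 V) => P ∈ openCluster (T ∩ (Cyc.edgeSet j w ∪ E₀)) s),
      K₁ (openCluster (T ∩ (Cyc.edgeSet j w ∪ E₀)) s) (openCluster (Tᶜ ∩ (Cyc.edgeSet j w ∪ E₀)) s) *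
        K₂ (openCluster (T ∩ (Cyc.edgeSet j w ∪ E₀)) s) (openCluster (Tᶜ ∩ (Cyc.edgeSet j w ∪ E₀)) s) := by
  rw [Set.union_comm]
  -- a fresh stub vertex `w k` (`1 ≤ k ≤ b`) lies on no pair of `E₀`
  have hfresh' : ∀ k, 0 < k → k ≤ b → ∀ f ∈ E₀, w k ∉ f := fun k hk hkb f hf hw => hnd f hf (hwfresh k hk hkb f hf hw)
  -- the entries of a stub pair
  have hends : ∀ e ∈ Cyc.edgeSet j w, ∀ v : V, v ∈ e → v = w 0 ∨ ∃ k, 0 < k ∧ k ≤ b ∧ v = w k := by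
    rintro e ⟨i, hi, rfl⟩ v hv
    rw [Cyc.edge] at hv
    rcases Sym2.mem_iff.1 hv with rfl | rfl
    · by_cases hi0 : i = 0
      · exact Or.inl (by rw [hi0])
      · exact Or.inr ⟨i, Nat.pos_of_ne_zero hi0, by omega, rfl⟩
    · exact Or.inr ⟨i + 1, Nat.succ_pos i, by omega, rfl⟩
  have hsep : ∀ e₁ ∈ E₀, ∀ e₂ ∈ Cyc.edgeSet j w, ∀ v : V, v ∈ e₁ → v ∈ e₂ → v = w 0 := by
    intro e₁ he₁ e₂ he₂ v hv₁ hv₂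
    rcases hends e₂ he₂ v hv₂ with h | ⟨k, hk, hkb, rfl⟩
    · exact h
    · exact absurd hv₁ (hfresh' k hk hkb e₁ he₁)
  have hs : ∀ e ∈ Cyc.edgeSet j w, s ∈ e → s = w 0 := by
    intro e he hse
    rcases hends e he s hse with h | ⟨k, hk, hkb, h⟩
    · exact h
    · exact absurd h (hsw k hk hkb)
  have hP : ∀ e ∈ Cyc.edgeSet j w, P ∈ e → P = w 0 := by
    intro e he hPe
    rcases hends e he P hPe with h | ⟨k, hk, hkb, h⟩
    · exact h
    · exact absurd h (hPw k hk hkb)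
  have hdis : Disjoint E₀ (Cyc.edgeSet j w) := by
    rw [Set.disjoint_left]
    rintro e he ⟨i, hi, rfl⟩
    exact hfresh' (i + 1) (Nat.succ_pos i) (by omega) _ he (by rw [Cyc.edge]; exact Sym2.mem_mk_right _ _)
  exact OneSum.oplus_nonneg hsep hs hdis hP hoplus K₁ K₂ hK₁ hso₁ hK₂ hso₂

variable {u : ℕ → V} {a : ℕ} {Q : V} (hu0 : u 0 = P) (hw0 : w 0 = Q)
  (hufresh : ∀ i, 0 < i → i ≤ a → ∀ f ∈ E₀ ∪ Cyc.edgeSet b w, u i ∈ f → f.IsDiag)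
  (huinj : ∀ i j, i ≤ a → j ≤ a → u i = u j → i = j)
  (hsu : ∀ i, 0 < i → i ≤ a → s ≠ u i) (hzu : ∀ i, 0 < i → i ≤ a → w b ≠ u i)
  (hmixed : ∀ K₁ K₂ : Set V → Set V → ℝ,
    (∀ ⦃A A' B B' : Set V⦄, A ⊆ A' → B' ⊆ B → K₁ A B ≤ K₁ A' B') → (∀ A B, 0 ≤ K₁ A B + K₁ B A) →
    (∀ ⦃A A' B B' : Set V⦄, A ⊆ A' → B' ⊆ B → K₂ A B ≤ K₂ A' B') → (∀ A B, 0 ≤ K₂ A B + K₂ B A) →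
    0 ≤ ∑ T ∈ Finset.univ.filter (fun T : Set (Sym2 V) => P ∈ openCluster (T ∩ E₀) s ∧ Q ∉ openCluster (Tᶜ ∩ E₀) s),
      K₁ (openCluster (T ∩ E₀) s) (openCluster (Tᶜ ∩ E₀) s) * K₂ (openCluster (T ∩ E₀) s) (openCluster (Tᶜ ∩ E₀) s))
include hu0 hw0 hufresh huinj hsu hzu hmixed

/-- **DUAL HANDLE THEOREM.**  `K` any loop-free finite graph (edge set `E₀`) through `s`; `P, Q` vertices of `K`; arms `u 0 = P, …, u a = y`
and `w 0 = Q, …, w b = z` of fresh vertices (`a, b ≥ 0`); `x` fresh, joined to `y` and `z`; `yz` not a pair of `H = K ∪ arms`;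
`E = H + xy + xz`.  If (⊕) `(E₀, s, P)` is ⊕-positive and (M) `TII_{E₀}(P, Q; K) ≥ 0` for all `K ∈ 𝒮`, then for all monotone `F, G`:
`0 ≤ Σ_{ω : ¬(x ∈ X_E ω ∧ x ∈ Y_E ω)} (F(X_E ω) − F(Y_E ω))·(G(X_E ω) − G(Y_E ω))`.  (The edge set of `H` is written
`Cyc.edgeSet a u ∪ (E₀ ∪ Cyc.edgeSet b w)` — the handle principle's `(E₀ ∪ stub) ∪ arm` with the arm listed first; the hypotheses are
genuinely weaker: (⊕) for `K` only.) [this work] -/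
theorem handle_vertex_sum_nonneg_of_oplus {x : V}
    (hx : ∀ f ∈ Cyc.edgeSet a u ∪ (E₀ ∪ Cyc.edgeSet b w), x ∈ f → f.IsDiag)
    (hxs : x ≠ s) (hxy : x ≠ u a) (hxz : x ≠ w b) (hyz : u a ≠ w b) (hg : s(u a, w b) ∉ Cyc.edgeSet a u ∪ (E₀ ∪ Cyc.edgeSet b w))
    {F G : Set V → ℝ} (hF : Monotone F) (hG : Monotone G) :
    0 ≤ ∑ ω ∈ Finset.univ.filter (fun ω : Set (Sym2 V) =>
        ¬ ((openGraph (ω ∩ insert s(x, u a) (insert s(x, w b) (Cyc.edgeSet a u ∪ (E₀ ∪ Cyc.edgeSet b w))))).Reachable s x ∧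
          (openGraph (ωᶜ ∩ insert s(x, u a) (insert s(x, w b) (Cyc.edgeSet a u ∪ (E₀ ∪ Cyc.edgeSet b w))))).Reachable s x)),
      (F (openCluster (ω ∩ insert s(x, u a) (insert s(x, w b) (Cyc.edgeSet a u ∪ (E₀ ∪ Cyc.edgeSet b w)))) s) -
          F (openCluster (ωᶜ ∩ insert s(x, u a) (insert s(x, w b) (Cyc.edgeSet a u ∪ (E₀ ∪ Cyc.edgeSet b w)))) s)) *
        (G (openCluster (ω ∩ insert s(x, u a) (insert s(x, w b) (Cyc.edgeSet a u ∪ (E₀ ∪ Cyc.edgeSet b w)))) s) -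
          G (openCluster (ωᶜ ∩ insert s(x, u a) (insert s(x, w b) (Cyc.edgeSet a u ∪ (E₀ ∪ Cyc.edgeSet b w)))) s)) := by
  -- (the statement writes the edge set of `H` as `arm ∪ (E₀ ∪ stub)`, the handle principle as `(E₀ ∪ stub) ∪ arm`: the same set)
  have hcomm : Cyc.edgeSet a u ∪ (E₀ ∪ Cyc.edgeSet b w) = (E₀ ∪ Cyc.edgeSet b w) ∪ Cyc.edgeSet a u := Set.union_comm _ _
  rw [hcomm] at hx hg ⊢
  refine handle_vertex_sum_nonneg_of hu0 hw0 hufresh hwfresh huinj hwinj hsu hsw hPw hzu ?_ hmixed hnd hx hxs hxy hxz hyz hg hF hG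
  intro j hj K₁ K₂ hK₁ hso₁ hK₂ hso₂
  have h := oplus_stub_of_oplus hnd hwfresh hsw hPw hoplus hj.le K₁ K₂ hK₁ hso₁ hK₂ hso₂
  rw [Set.union_comm] at h
  exact h

end Pendant

end Antithetic

end Summit.CriticalPhenomena.PercolationContinuityZ3.Theorems
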